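import Literature.AnabelianGeometry.SemiGraphs.TemperedFirstBranchAtHostOfSaturatedSeq
import Literature.AnabelianGeometry.SemiGraphs.TemperedHostEdgeEndsOfTopCyclic
import HarnessLib

/-!
# [SemiAnbd] Thm 3.7 (iii) / Cor 3.9 (R3c), ARBITRARY edge groups, saturation along the fixed edge-point
# sequences (LIMIT hosts) only: the TWO-POINT FIXED LOCUS (proof-only)

Mochizuki, *Semi-graphs of anabelioids*, Publ. RIMS **42** (2006), §3 Theorem 3.7 (iii), proof p. 41,
third paragraph ("if `H` fixes two vertices of `𝒢_{∞,j}`, then these two vertices are joined to one another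
by a single edge"), with the author's *Comments* (2020) (6)(b); Corollary 3.9, proof p. 43 l. 13 (the
cell's step (R3c), FACT-LIST rows F-2772 `EdgeLikeCentralizerAt` / F-2773 `EdgeLikeCentralizer`)
[cite: MochizukiSemiAnbd2006, Thm 3.7(iii) p.41].

PROOF-ONLY (cell abc-iut, block F, seat abc-iut-f-176 gen 5; refinement of this seat's p498806
`TemperedHostEdgeEndsOfSaturated` — hypotheses on LIMIT hosts only; no definition, no named fact).  At the canonical tower
of a countable `𝒢` satisfying the hypotheses of Thm. 3.7 — arbitrary edge groups, arbitrary underlying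
graph — let `C ≠ 1` fix the tree edges `Q.edge n` of a compatible edge-point sequence `Q` over a base edge
`e₀`.  The saturation hypothesis of p498806 (all `C`-fixed tree edges of `𝔾̃_n`) is weakened to the COMPATIBLE
`C`-FIXED EDGE-POINT SEQUENCES `T` (the limit hosts of `C`): every element of `Gal(𝒢_{∞,n}/𝒢)` fixing
`T.edge n` and trivial in `Gal(𝒢_{∞,j}/𝒢)` lies in `ρ_n(C)`.  With
`exists_fixed_branch_at_host_of_firstBranch_of_saturatedSeq`:
* `edgeOf_firstBranch_eq_edge_of_saturatedSeq` — HOST STEP (p493068's proof verbatim: abc-iut-w6-d062's depth lemmas `eventually_not_fixed_pair_of_ne_base_pair` /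
  `eventually_fold_same_base_pair` at the fixed pair of base branches);
* `exists_branch_edge_abuts_of_fixed_of_saturatedSeq` — TWO-POINT FIXED LOCUS at a saturated level;
  `dist_le_four_of_fixed_pair_of_saturatedSeq` — `hbdd` with bound `4` there;
* `exists_branch_edge_abuts_of_fixed_of_eventually_saturatedSeq` — the two-point locus at EVERY level when the
  reference levels `≥ j₀` are saturated (push-down along the transition maps; the anchor of an open edge
  piece `ψ(U)` is itself saturated only from the level `j(U)` on); the `hbdd` form is in the sequel.
The residual of the bare ∀ F-2773 after abc-iut-f-172's top-cyclic class (p493572) and this file is thus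
«a fold at a host that is NEITHER cyclic NOR saturated».

Honest framing: one sufficient condition; the ∀-closures F-2773 / F-1732 are NOT claimed; nothing here
bears on [IUTchIII] Cor. 3.12; typed ≠ proved elsewhere.
-/

namespace Literature.AnabelianGeometry.SemiGraphs

namespace ProfiniteSemiGraph

open CategoryTheory Topology

universe u

variable (𝒢 : ProfiniteSemiGraph.{u}) (h37 : 𝒢.Thm37Hypotheses)

/-! ### The HOST STEP under saturation -/

/-- **HOST STEP under saturation.**  Canonical tower, arbitrary edge groups, `C ≠ 1` fixing the tree edges
`Q.edge n` of an edge-point sequence `Q` over `e₀`, `b₀` a branch of `e₀` at `v₀` and `P = Q.gluePointSeq b₀`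
the host over `v₀`.  For every compatible `C`-fixed vertex system `x` and level `j`: if the geodesic of
`𝔾̃_j` from `P.vertex j` to `x_j` starts with a branch `β`, then the edge of `β` IS the host edge `Q.edge j`.
(By `exists_fixed_branch_at_host_of_firstBranch`, at every deep level `n` the host vertex carries a
`C`-fixed branch `α` with image `β` next to the `C`-fixed host branch over `b₀`; if `β` lies over a base
branch `≠ b₀` this contradicts estrangement in depth, `eventually_not_fixed_pair_of_ne_base_pair`; if it
lies over `b₀`, the same-branch fold `eventually_fold_same_base_pair` identifies the images at level `j`.)
[cite: MochizukiSemiAnbd2006, Thm 3.7(iii) p.41] -/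
theorem edgeOf_firstBranch_eq_edge_of_saturatedSeq
    (C : Subgroup (𝒢.temperedPiChart h37.toProp36Hypotheses).G) (hC : C ≠ ⊥) {e₀ : 𝒢.graph.Edge}
    (Q : (𝒢.galoisLevelData h37.toProp36Hypotheses).EdgeSeq h37.toProp36Hypotheses.isCountable e₀)
    (hQ : ∀ g ∈ C, ∀ n, ((𝒢.galoisLevelData h37.toProp36Hypotheses).treeAct
      h37.toProp36Hypotheses.isCountable n g).hom.edgeMap (Q.edge n) = Q.edge n)
    {b₀ : 𝒢.graph.Branch} {v₀ : 𝒢.graph.Vertex} (hb₀ : 𝒢.graph.abuts b₀ = some v₀)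
    (hb₀e : 𝒢.graph.edgeOf b₀ = e₀)
    (x : ∀ n, ((𝒢.galoisLevelData h37.toProp36Hypotheses).tree n).Vertex)
    (hx : ∀ ⦃i n : ℕ⦄ (hin : i ≤ n),
      ((𝒢.galoisLevelData h37.toProp36Hypotheses).treeTrans hin).vertexMap (x n) = x i)
    (hfx : ∀ g ∈ C, ∀ n, ((𝒢.galoisLevelData h37.toProp36Hypotheses).treeAct
      h37.toProp36Hypotheses.isCountable n g).hom.vertexMap (x n) = x n)
    (j : ℕ)
    (hsat : ∀ (n : ℕ) (hjn : j ≤ n) (e' : 𝒢.graph.Edge) (T : (𝒢.galoisLevelData h37.toProp36Hypotheses).EdgeSeq h37.toProp36Hypotheses.isCountable e'),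
      (∀ g ∈ C, ∀ m, ((𝒢.galoisLevelData h37.toProp36Hypotheses).treeAct h37.toProp36Hypotheses.isCountable m g).hom.edgeMap (T.edge m) = T.edge m) →
      ∀ q : (𝒢.galoisLevelData h37.toProp36Hypotheses).Gal h37.toProp36Hypotheses.isCountable n, (𝒢.galoisLevelData h37.toProp36Hypotheses).mapLE h37.toProp36Hypotheses.isCountable hjn q = 1 →
        ((𝒢.galoisLevelData h37.toProp36Hypotheses).galTreeAct h37.toProp36Hypotheses.isCountable n q).hom.edgeMap (T.edge n) = T.edge n →
        q ∈ C.map ((𝒢.galoisLevelData h37.toProp36Hypotheses).proj h37.toProp36Hypotheses.isCountable n))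
    (p : ((𝒢.galoisLevelData h37.toProp36Hypotheses).tree j).subdivision.Walk
      (Sum.inl ((Q.gluePointSeq b₀ v₀ hb₀ hb₀e).vertex j)) (Sum.inl (x j))) (hp : p.IsPath)
    {β : ((𝒢.galoisLevelData h37.toProp36Hypotheses).tree j).Branch} (hβ : p.getVert 1 = Sum.inr (Sum.inr β)) :
    ((𝒢.galoisLevelData h37.toProp36Hypotheses).tree j).edgeOf β = Q.edge j := by
  classical
  let D := 𝒢.galoisLevelData h37.toProp36Hypotheses
  let hc := h37.toProp36Hypotheses.isCountable
  let P := Q.gluePointSeq b₀ v₀ hb₀ hb₀e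
  have hfP := 𝒢.treeAct_vertexMap_gluePointSeq_vertex_of_edgeMap_edge h37 C Q hQ hb₀ hb₀e
  -- `β` abuts `P.vertex j`, over a base branch `cb` at `v₀`
  have hlen : 0 < p.length := by
    by_contra h
    rw [p.getVert_of_length_le (by omega)] at hβ
    simp at hβ
  have h01 := p.adj_getVert_succ (i := 0) hlen
  rw [SimpleGraph.Walk.getVert_zero, Nat.zero_add, hβ] at h01
  have hba : (D.tree j).abuts β = some (P.vertex j) := by
    obtain ⟨b, hba, hbb⟩ := ((D.tree j).subdivision_adj_inl_iff _ _).mp h01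
    have hbβ : b = β := by simpa using hbb.symm
    rw [← hbβ]; exact hba
  have hcb : 𝒢.graph.abuts ((D.treeProj j).branchMap β) = some v₀ := by
    rw [(D.treeProj j).abuts_branchMap β _ hba, P.treeProj_vertexMap_vertex]
  -- a non-trivial element of `C`, non-trivial at some level `j₀`
  obtain ⟨c₁, hc₁C, hc₁1⟩ : ∃ c ∈ C, c ≠ 1 := by
    by_contra h
    push Not at h
    exact hC ((Subgroup.eq_bot_iff_forall C).2 h)
  obtain ⟨j₀, hj₀⟩ := 𝒢.exists_proj_ne_one h37.toProp36Hypotheses c₁ hc₁1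
  -- the host branch over `b₀` at level `n`, its edge `Q.edge n` being `C`-fixed
  have hhost : ∀ n, ∃ δ : (D.tree n).Branch, (D.tree n).edgeOf δ = Q.edge n ∧
      (D.treeProj n).branchMap δ = b₀ ∧ (D.tree n).abuts δ = some (P.vertex n) :=
    fun n => Q.exists_branch_abuts_gluePointSeq_vertex b₀ v₀ hb₀ hb₀e n
  by_cases hbb₀ : (D.treeProj j).branchMap β = b₀
  · -- the first branch lies over `b₀`: fold onto the host edge
    obtain ⟨K, -, hjK, hK⟩ := 𝒢.eventually_fold_same_base_pair h37 c₁ j₀ hj₀ v₀ hb₀ j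
    obtain ⟨α, hαa, hαimg, hαfix⟩ := 𝒢.exists_fixed_branch_at_host_of_firstBranch_of_saturatedSeq h37 C P hfP x hx
      hfx p hp hβ hjK (hsat K hjK)
    obtain ⟨δ, hδe, hδb, hδa⟩ := hhost K
    have hαb : (D.treeProj K).branchMap α = b₀ := by
      rw [D.treeProj_branchMap_eq_treeProj_treeTrans hjK, hαimg, hbb₀]
    have hδfix : (D.treeAct hc K c₁).hom.edgeMap ((D.tree K).edgeOf δ) = (D.tree K).edgeOf δ := by
      rw [hδe]; exact hQ c₁ hc₁C K
    have hfold := hK K le_rfl P α δ hαb hδb hαa hδa (hαfix c₁ hc₁C) hδfix hjK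
    rw [hαimg] at hfold
    rw [hfold, (D.treeTrans hjK).edgeOf_branchMap δ, hδe, Q.treeTrans_edge hjK]
  · -- a foreign first branch: excluded by estrangement in depth at the pair `(b₀, cb)`
    exfalso
    obtain ⟨K, -, hK⟩ := 𝒢.eventually_not_fixed_pair_of_ne_base_pair h37 c₁ j₀ hj₀ v₀ hb₀ hcb (Ne.symm hbb₀)
    obtain ⟨α, hαa, hαimg, hαfix⟩ := 𝒢.exists_fixed_branch_at_host_of_firstBranch_of_saturatedSeq h37 C P hfP x hx
      hfx p hp hβ (le_max_left j K) (hsat _ (le_max_left j K))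
    obtain ⟨δ, hδe, hδb, hδa⟩ := hhost (max j K)
    have hαb : (D.treeProj (max j K)).branchMap α = (D.treeProj j).branchMap β := by
      rw [D.treeProj_branchMap_eq_treeProj_treeTrans (le_max_left j K), hαimg]
    have hδfix : (D.treeAct hc (max j K) c₁).hom.edgeMap ((D.tree (max j K)).edgeOf δ) =
        (D.tree (max j K)).edgeOf δ := by
      rw [hδe]; exact hQ c₁ hc₁C (max j K)
    exact hK (max j K) (le_max_right j K) P δ α hδb hαb hδa hαa hδfix (hαfix c₁ hc₁C)

/-! ### TWO-POINT FIXED LOCUS: every compatible fixed system is an end of the host edge -/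

/-- **TWO-POINT FIXED LOCUS under saturation at the level** ([SemiAnbd] Thm 3.7 (iii), second sentence;
arbitrary edge groups, ANY underlying graph; hypothesis: every `C`-fixed tree edge of every `𝔾̃_n`, `n ≥ j`, is
saturated relative to `j`).  Canonical tower; `C ≠ 1` fixes the tree edges `Q.edge n` of
an edge-point sequence `Q` over the base edge `e₀` with branches `b₁ ≠ b₂` at `v₁`, `v₂`.  Then EVERY
compatible `C`-fixed vertex system `x` is, at every level `j`, an END of the host edge: some branch of
`Q.edge j` abuts to `x_j`.  (Host step at `v₁`: the geodesic from the `b₁`-end to `x_j` runs along `Q.edge j`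
to the `b₂`-end; host step at `v₂`: it cannot continue.) [cite: MochizukiSemiAnbd2006, Thm 3.7(iii) p.41] -/
theorem exists_branch_edge_abuts_of_fixed_of_saturatedSeq
    (C : Subgroup (𝒢.temperedPiChart h37.toProp36Hypotheses).G) (hC : C ≠ ⊥) {e₀ : 𝒢.graph.Edge}
    (Q : (𝒢.galoisLevelData h37.toProp36Hypotheses).EdgeSeq h37.toProp36Hypotheses.isCountable e₀)
    (hQ : ∀ g ∈ C, ∀ n, ((𝒢.galoisLevelData h37.toProp36Hypotheses).treeAct
      h37.toProp36Hypotheses.isCountable n g).hom.edgeMap (Q.edge n) = Q.edge n)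
    {b₁ b₂ : 𝒢.graph.Branch} (hb12 : b₁ ≠ b₂) (hb₁e : 𝒢.graph.edgeOf b₁ = e₀)
    (hb₂e : 𝒢.graph.edgeOf b₂ = e₀) {v₁ v₂ : 𝒢.graph.Vertex} (hb₁ : 𝒢.graph.abuts b₁ = some v₁)
    (hb₂ : 𝒢.graph.abuts b₂ = some v₂)
    (x : ∀ n, ((𝒢.galoisLevelData h37.toProp36Hypotheses).tree n).Vertex)
    (hx : ∀ ⦃i n : ℕ⦄ (hin : i ≤ n),
      ((𝒢.galoisLevelData h37.toProp36Hypotheses).treeTrans hin).vertexMap (x n) = x i)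
    (hfx : ∀ g ∈ C, ∀ n, ((𝒢.galoisLevelData h37.toProp36Hypotheses).treeAct
      h37.toProp36Hypotheses.isCountable n g).hom.vertexMap (x n) = x n) (j : ℕ)
    (hsat : ∀ (n : ℕ) (hjn : j ≤ n) (e' : 𝒢.graph.Edge) (T : (𝒢.galoisLevelData h37.toProp36Hypotheses).EdgeSeq h37.toProp36Hypotheses.isCountable e'),
      (∀ g ∈ C, ∀ m, ((𝒢.galoisLevelData h37.toProp36Hypotheses).treeAct h37.toProp36Hypotheses.isCountable m g).hom.edgeMap (T.edge m) = T.edge m) →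
      ∀ q : (𝒢.galoisLevelData h37.toProp36Hypotheses).Gal h37.toProp36Hypotheses.isCountable n, (𝒢.galoisLevelData h37.toProp36Hypotheses).mapLE h37.toProp36Hypotheses.isCountable hjn q = 1 →
        ((𝒢.galoisLevelData h37.toProp36Hypotheses).galTreeAct h37.toProp36Hypotheses.isCountable n q).hom.edgeMap (T.edge n) = T.edge n →
        q ∈ C.map ((𝒢.galoisLevelData h37.toProp36Hypotheses).proj h37.toProp36Hypotheses.isCountable n))
    :
    ∃ δ : ((𝒢.galoisLevelData h37.toProp36Hypotheses).tree j).Branch,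
      ((𝒢.galoisLevelData h37.toProp36Hypotheses).tree j).edgeOf δ = Q.edge j ∧
      ((𝒢.galoisLevelData h37.toProp36Hypotheses).tree j).abuts δ = some (x j) := by
  classical
  let D := 𝒢.galoisLevelData h37.toProp36Hypotheses
  let hc := h37.toProp36Hypotheses.isCountable
  let P₁ := Q.gluePointSeq b₁ v₁ hb₁ hb₁e
  let P₂ := Q.gluePointSeq b₂ v₂ hb₂ hb₂e
  obtain ⟨δ₁, hδ₁e, hδ₁b, hδ₁a⟩ := Q.exists_branch_abuts_gluePointSeq_vertex b₁ v₁ hb₁ hb₁e j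
  obtain ⟨δ₂, hδ₂e, hδ₂b, hδ₂a⟩ := Q.exists_branch_abuts_gluePointSeq_vertex b₂ v₂ hb₂ hb₂e j
  have hδ12 : δ₁ ≠ δ₂ := fun h => hb12 (by rw [← hδ₁b, ← hδ₂b, h])
  have ha12 : P₁.vertex j ≠ P₂.vertex j := Q.gluePointSeq_vertex_ne j b₁ b₂ hb12 v₁ v₂ hb₁ hb₂ hb₁e hb₂e
  -- the two branches of the tree edge `Q.edge j` are `δ₁`, `δ₂`
  have htwo : ∀ δ : (D.tree j).Branch, (D.tree j).edgeOf δ = Q.edge j → δ = δ₁ ∨ δ = δ₂ := by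
    intro δ hδ
    obtain ⟨c₁, c₂, -, -, -, hall⟩ := (D.tree j).two_branches (Q.edge j)
    rcases hall δ₁ hδ₁e with h₁ | h₁ <;> rcases hall δ₂ hδ₂e with h₂ | h₂ <;> rcases hall δ hδ with h | h
    all_goals first
      | exact (hδ12 (h₁.trans h₂.symm)).elim
      | exact Or.inl (h.trans h₁.symm)
      | exact Or.inr (h.trans h₂.symm)
  by_cases hx1 : x j = P₁.vertex j
  · exact ⟨δ₁, hδ₁e, by rw [hx1]; exact hδ₁a⟩
  -- the geodesic from the `b₁`-end to `x_j`
  have hT := (D.isTree_tree j).isTree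
  let pp : (D.tree j).subdivision.Path (Sum.inl (P₁.vertex j)) (Sum.inl (x j)) := (hT.connected _ _).some.toPath
  let p := pp.1
  have hp : p.IsPath := pp.2
  have hinj := hp.getVert_injOn
  have hend : p.getVert p.length = Sum.inl (x j) := p.getVert_length
  have hlen1 : 0 < p.length := by
    by_contra h
    have h0 : p.length = 0 := by omega
    rw [h0, SimpleGraph.Walk.getVert_zero] at hend
    exact hx1 (Sum.inl_injective hend).symm
  -- node 1: a branch `β` at the `b₁`-end; by the host step its edge is `Q.edge j`, so `β = δ₁`
  have h01 := p.adj_getVert_succ (i := 0) hlen1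
  rw [SimpleGraph.Walk.getVert_zero, Nat.zero_add] at h01
  obtain ⟨β, hβa, hp1⟩ := ((D.tree j).subdivision_adj_inl_iff _ _).mp h01
  have hβe : (D.tree j).edgeOf β = Q.edge j :=
    𝒢.edgeOf_firstBranch_eq_edge_of_saturatedSeq h37 C hC Q hQ hb₁ hb₁e x hx hfx j hsat p hp hp1
  have hβδ₁ : β = δ₁ := by
    rcases htwo β hβe with h | h
    · exact h
    · exfalso
      rw [h, hδ₂a] at hβa
      exact ha12 (Option.some.inj hβa).symm
  -- node 2: the point of `Q.edge j`
  have hlen2 : 2 ≤ p.length := by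
    by_contra h
    have h1 : p.length = 1 := by omega
    rw [h1] at hend; rw [hend] at hp1; simp at hp1
  have h12 := p.adj_getVert_succ (i := 1) (by omega)
  rw [hp1] at h12
  have hp2 : p.getVert 2 = Sum.inr (Sum.inl (Q.edge j)) := by
    rcases ((D.tree j).subdivision_adj_branch_iff β _).mp h12 with h | ⟨u, hu, h⟩
    · rw [← hβe]; exact h
    · exfalso
      rw [hβa] at hu; cases hu
      have h0 : p.getVert (1 + 1) = p.getVert 0 := by rw [h, SimpleGraph.Walk.getVert_zero]
      have := hinj (by simp; omega) (by simp) h0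
      omega
  -- node 3: the other branch `δ₂` of `Q.edge j`
  have hlen3 : 3 ≤ p.length := by
    by_contra h
    have h2 : p.length = 2 := by omega
    rw [h2] at hend; rw [hend] at hp2; simp at hp2
  have h23 := p.adj_getVert_succ (i := 2) (by omega)
  rw [hp2] at h23
  obtain ⟨β₃, hβ₃e, hp3⟩ := ((D.tree j).subdivision_adj_edge_iff _ _).mp h23
  have hβ₃β : β₃ ≠ β := by
    intro h
    rw [h] at hp3
    have h0 : p.getVert (2 + 1) = p.getVert 1 := by rw [hp3, hp1]
    have := hinj (by simp; omega) (by simp; omega) h0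
    omega
  have hβ₃δ₂ : β₃ = δ₂ := by
    rcases htwo β₃ hβ₃e with h | h
    · exact (hβ₃β (h.trans hβδ₁.symm)).elim
    · exact h
  -- node 4: the `b₂`-end
  have hlen4 : 4 ≤ p.length := by
    by_contra h
    have h3 : p.length = 3 := by omega
    rw [h3] at hend; rw [hend] at hp3; simp at hp3
  have h34 := p.adj_getVert_succ (i := 3) (by omega)
  rw [hp3] at h34
  have hp4 : p.getVert 4 = Sum.inl (P₂.vertex j) := by
    rcases ((D.tree j).subdivision_adj_branch_iff β₃ _).mp h34 with h | ⟨u, hu, h⟩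
    · exfalso
      rw [hβ₃e] at h
      have h0 : p.getVert (3 + 1) = p.getVert 2 := by rw [h, hp2]
      have := hinj (by simp; omega) (by simp; omega) h0
      omega
    · rw [hβ₃δ₂, hδ₂a] at hu; cases hu; exact h
  by_cases hx2 : x j = P₂.vertex j
  · exact ⟨δ₂, hδ₂e, by rw [hx2]; exact hδ₂a⟩
  -- node 5 would be a branch at the `b₂`-end with edge `Q.edge j` again: impossible
  exfalso
  have hlen5 : 5 ≤ p.length := by
    by_contra h
    have h4 : p.length = 4 := by omega
    rw [h4] at hend; rw [hend] at hp4
    exact hx2 (Sum.inl_injective hp4)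
  have h45 := p.adj_getVert_succ (i := 4) (by omega)
  rw [hp4] at h45
  obtain ⟨β₅, hβ₅a, hp5⟩ := ((D.tree j).subdivision_adj_inl_iff _ _).mp h45
  -- the tail geodesic from the `b₂`-end
  let p' : (D.tree j).subdivision.Walk (Sum.inl (P₂.vertex j)) (Sum.inl (x j)) := (p.drop 4).copy hp4 rfl
  have hp' : p'.IsPath := by
    refine SimpleGraph.Walk.IsPath.mk' ?_
    rw [SimpleGraph.Walk.support_copy, SimpleGraph.Walk.drop_support_eq_support_drop_min]
    exact hp.support_nodup.sublist (List.drop_sublist _ _)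
  have hp'1 : p'.getVert 1 = Sum.inr (Sum.inr β₅) := by
    rw [SimpleGraph.Walk.getVert_copy, SimpleGraph.Walk.drop_getVert]
    exact hp5
  have hβ₅e : (D.tree j).edgeOf β₅ = Q.edge j :=
    𝒢.edgeOf_firstBranch_eq_edge_of_saturatedSeq h37 C hC Q hQ hb₂ hb₂e x hx hfx j hsat p' hp' hp'1
  rcases htwo β₅ hβ₅e with h | h
  · rw [h, ← hβδ₁] at hp5
    have h0 : p.getVert (4 + 1) = p.getVert 1 := by rw [hp5, hp1]
    have := hinj (by simp; omega) (by simp; omega) h0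
    omega
  · rw [h, ← hβ₃δ₂] at hp5
    have h0 : p.getVert (4 + 1) = p.getVert 3 := by rw [hp5, hp3]
    have := hinj (by simp; omega) (by simp; omega) h0
    omega

/-- **`hbdd` with bound `4` at a saturated level.**  Under the same hypotheses, two compatible
`C`-fixed vertex systems are at every level equal or the two ends of the host edge: subdivision distance
`≤ 4`. [cite: MochizukiSemiAnbd2006, Thm 3.7(iii) p.41] -/
theorem dist_le_four_of_fixed_pair_of_saturatedSeq
    (C : Subgroup (𝒢.temperedPiChart h37.toProp36Hypotheses).G) (hC : C ≠ ⊥) {e₀ : 𝒢.graph.Edge}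
    (Q : (𝒢.galoisLevelData h37.toProp36Hypotheses).EdgeSeq h37.toProp36Hypotheses.isCountable e₀)
    (hQ : ∀ g ∈ C, ∀ n, ((𝒢.galoisLevelData h37.toProp36Hypotheses).treeAct
      h37.toProp36Hypotheses.isCountable n g).hom.edgeMap (Q.edge n) = Q.edge n)
    {b₁ b₂ : 𝒢.graph.Branch} (hb12 : b₁ ≠ b₂) (hb₁e : 𝒢.graph.edgeOf b₁ = e₀)
    (hb₂e : 𝒢.graph.edgeOf b₂ = e₀) {v₁ v₂ : 𝒢.graph.Vertex} (hb₁ : 𝒢.graph.abuts b₁ = some v₁)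
    (hb₂ : 𝒢.graph.abuts b₂ = some v₂)
    (x x' : ∀ n, ((𝒢.galoisLevelData h37.toProp36Hypotheses).tree n).Vertex)
    (hx : ∀ ⦃i n : ℕ⦄ (hin : i ≤ n),
      ((𝒢.galoisLevelData h37.toProp36Hypotheses).treeTrans hin).vertexMap (x n) = x i)
    (hx' : ∀ ⦃i n : ℕ⦄ (hin : i ≤ n),
      ((𝒢.galoisLevelData h37.toProp36Hypotheses).treeTrans hin).vertexMap (x' n) = x' i)
    (hfx : ∀ g ∈ C, ∀ n, ((𝒢.galoisLevelData h37.toProp36Hypotheses).treeAct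
      h37.toProp36Hypotheses.isCountable n g).hom.vertexMap (x n) = x n)
    (hfx' : ∀ g ∈ C, ∀ n, ((𝒢.galoisLevelData h37.toProp36Hypotheses).treeAct
      h37.toProp36Hypotheses.isCountable n g).hom.vertexMap (x' n) = x' n) (j : ℕ)
    (hsat : ∀ (n : ℕ) (hjn : j ≤ n) (e' : 𝒢.graph.Edge) (T : (𝒢.galoisLevelData h37.toProp36Hypotheses).EdgeSeq h37.toProp36Hypotheses.isCountable e'),
      (∀ g ∈ C, ∀ m, ((𝒢.galoisLevelData h37.toProp36Hypotheses).treeAct h37.toProp36Hypotheses.isCountable m g).hom.edgeMap (T.edge m) = T.edge m) →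
      ∀ q : (𝒢.galoisLevelData h37.toProp36Hypotheses).Gal h37.toProp36Hypotheses.isCountable n, (𝒢.galoisLevelData h37.toProp36Hypotheses).mapLE h37.toProp36Hypotheses.isCountable hjn q = 1 →
        ((𝒢.galoisLevelData h37.toProp36Hypotheses).galTreeAct h37.toProp36Hypotheses.isCountable n q).hom.edgeMap (T.edge n) = T.edge n →
        q ∈ C.map ((𝒢.galoisLevelData h37.toProp36Hypotheses).proj h37.toProp36Hypotheses.isCountable n))
    :
    ((𝒢.galoisLevelData h37.toProp36Hypotheses).tree j).subdivision.dist (Sum.inl (x j)) (Sum.inl (x' j)) ≤ 4 := by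
  obtain ⟨δ, hδe, hδa⟩ :=
    𝒢.exists_branch_edge_abuts_of_fixed_of_saturatedSeq h37 C hC Q hQ hb12 hb₁e hb₂e hb₁ hb₂ x hx hfx j hsat
  obtain ⟨δ', hδ'e, hδ'a⟩ :=
    𝒢.exists_branch_edge_abuts_of_fixed_of_saturatedSeq h37 C hC Q hQ hb12 hb₁e hb₂e hb₁ hb₂ x' hx' hfx' j hsat
  obtain ⟨a', hends, hdist⟩ := SemiGraph.exists_ends_dist_le_four (Q.edge j) δ hδe hδa
  rcases hends δ' (x' j) hδ'e hδ'a with h | h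
  · rw [h, SimpleGraph.dist_self]; exact Nat.zero_le _
  · rw [h]; exact hdist


/-! ### From the saturated levels down to every level -/

/-- **TWO-POINT FIXED LOCUS at EVERY level from EVENTUAL saturation.**  If every `C`-fixed tree edge of
`𝔾̃_n` is saturated relative to every reference level `j` with `j₀ ≤ j ≤ n` (for the open piece `C = ψ(U)` of
an edge-like subgroup the anchor itself is saturated only from the level `j(U)` on), then at EVERY level `j` —
also below `j₀` — a compatible `C`-fixed vertex system is an end of the host edge: the conclusion at level
`max j j₀` is pushed down along the transition map `𝔾̃_{max j j₀} → 𝔾̃_j`, which carries `Q.edge` to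
`Q.edge` and `x` to `x`. [cite: MochizukiSemiAnbd2006, Thm 3.7(iii) p.41] -/
theorem exists_branch_edge_abuts_of_fixed_of_eventually_saturatedSeq
    (C : Subgroup (𝒢.temperedPiChart h37.toProp36Hypotheses).G) (hC : C ≠ ⊥) {e₀ : 𝒢.graph.Edge}
    (Q : (𝒢.galoisLevelData h37.toProp36Hypotheses).EdgeSeq h37.toProp36Hypotheses.isCountable e₀)
    (hQ : ∀ g ∈ C, ∀ n, ((𝒢.galoisLevelData h37.toProp36Hypotheses).treeAct
      h37.toProp36Hypotheses.isCountable n g).hom.edgeMap (Q.edge n) = Q.edge n)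
    {b₁ b₂ : 𝒢.graph.Branch} (hb12 : b₁ ≠ b₂) (hb₁e : 𝒢.graph.edgeOf b₁ = e₀)
    (hb₂e : 𝒢.graph.edgeOf b₂ = e₀) {v₁ v₂ : 𝒢.graph.Vertex} (hb₁ : 𝒢.graph.abuts b₁ = some v₁)
    (hb₂ : 𝒢.graph.abuts b₂ = some v₂)
    (x : ∀ n, ((𝒢.galoisLevelData h37.toProp36Hypotheses).tree n).Vertex)
    (hx : ∀ ⦃i n : ℕ⦄ (hin : i ≤ n),
      ((𝒢.galoisLevelData h37.toProp36Hypotheses).treeTrans hin).vertexMap (x n) = x i)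
    (hfx : ∀ g ∈ C, ∀ n, ((𝒢.galoisLevelData h37.toProp36Hypotheses).treeAct
      h37.toProp36Hypotheses.isCountable n g).hom.vertexMap (x n) = x n) (j₀ : ℕ)
    (hsat : ∀ (j : ℕ), j₀ ≤ j → ∀ (n : ℕ) (hjn : j ≤ n) (e' : 𝒢.graph.Edge) (T : (𝒢.galoisLevelData h37.toProp36Hypotheses).EdgeSeq h37.toProp36Hypotheses.isCountable e'),
      (∀ g ∈ C, ∀ m, ((𝒢.galoisLevelData h37.toProp36Hypotheses).treeAct h37.toProp36Hypotheses.isCountable m g).hom.edgeMap (T.edge m) = T.edge m) →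
      ∀ q : (𝒢.galoisLevelData h37.toProp36Hypotheses).Gal h37.toProp36Hypotheses.isCountable n, (𝒢.galoisLevelData h37.toProp36Hypotheses).mapLE h37.toProp36Hypotheses.isCountable hjn q = 1 →
        ((𝒢.galoisLevelData h37.toProp36Hypotheses).galTreeAct h37.toProp36Hypotheses.isCountable n q).hom.edgeMap (T.edge n) = T.edge n →
        q ∈ C.map ((𝒢.galoisLevelData h37.toProp36Hypotheses).proj h37.toProp36Hypotheses.isCountable n))
    (j : ℕ) :
    ∃ δ : ((𝒢.galoisLevelData h37.toProp36Hypotheses).tree j).Branch,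
      ((𝒢.galoisLevelData h37.toProp36Hypotheses).tree j).edgeOf δ = Q.edge j ∧
      ((𝒢.galoisLevelData h37.toProp36Hypotheses).tree j).abuts δ = some (x j) := by
  let D := 𝒢.galoisLevelData h37.toProp36Hypotheses
  have hj : j ≤ max j j₀ := le_max_left j j₀
  obtain ⟨δ₀, hδ₀e, hδ₀a⟩ := 𝒢.exists_branch_edge_abuts_of_fixed_of_saturatedSeq h37 C hC Q hQ hb12 hb₁e hb₂e hb₁
    hb₂ x hx hfx (max j j₀) (hsat (max j j₀) (le_max_right j j₀))
  refine ⟨(D.treeTrans hj).branchMap δ₀, ?_, ?_⟩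
  · rw [(D.treeTrans hj).edgeOf_branchMap δ₀, hδ₀e, Q.treeTrans_edge hj]
  · rw [(D.treeTrans hj).abuts_branchMap δ₀ (x (max j j₀)) hδ₀a, hx hj]

end ProfiniteSemiGraph

end Literature.AnabelianGeometry.SemiGraphs
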